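import Literature.Barriers.AtomisticToContinuum.CohnElkiesNotSharp3DProofs

/-!
# The Cohn–Elkies bound is not sharp in `ℝ³` (Li 2022) — autoconvolution certificates

Second step towards discharging `Literature.Barriers.AtomisticToContinuum.Li2022_dualCertificate53`
(the computational content of Li 2022, Theorem 3; see `CohnElkiesNotSharp3DProofs.lean` for the
reduction of the barrier fact `Li2022_cohnElkies3D` to it).

## What is here

A de-normalised discrete dual certificate (`IsDiscreteDualCertificate R ν` on `ℤ_m^d`: `ν ≥ 0`,
`ν = 0` on the shell `0 < |x|² < R`, `Re ν̂ ≥ 0`, `ν(0) > 0`) is produced from ANY even integer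
function `β` on `ℤ_m^d` ("autoconvolution certificate"):

* `autoconv β = β ∗ β` is positive definite — `∑_x (β∗β)(x) e(⟨x,y⟩) = β̂(y)²` with `β̂(y)` real
  for even `β` (`sum_autoconv_mul_stdAddChar`, `intHat_im_eq_zero`, `re_sum_autoconv_nonneg`);
* the **corrected certificate** `certNu R β`: `β∗β` set to `0` on the shell, to `max(β∗β, 0)`
  off the shell, and increased at the origin by the `ℓ¹`-mass `corrMass R β` of these changes, is
  a discrete dual certificate (`isDiscreteDualCertificate_certNu`: the correction's character sums
  are bounded by `corrMass`, which the origin term supplies exactly);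
* its value `discreteDualBound R (certNu R β) = (√R/2)^d m^{-d} certTot/certNu0` exceeds a
  rational `Tn/Td` as soon as the INTEGER inequality `4^d m^{2d} certNu0² Tn² < R^d certTot² Td²`
  holds (`lt_discreteDualBound_certNu`, `exists_dualCertificate_of_even`).

So `Li2022_dualCertificate53` follows from exhibiting an even `β : ℤ₅₃³ → ℤ` and evaluating the two
integers `certNu0 89 β`, `certTot 89 β` (sums over the `53³` points of values of `β∗β`) — a
finite computation, carried out by kernel evaluation in the sequel file. This is how Li's floating
point dual solution is turned into an exact certificate here: instead of Li's rounding of `μ` to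
rationals with an `ε`-buffer on `λ = Fμ ≥ ε` and interval arithmetic for `λ ≥ 0` (§5, p. 9), we
take `β ≈ F⁻¹√λ` rounded to integers, whose autoconvolution is positive definite by structure, and
pay for the rounding at the origin.

## Sources

* R. Li, arXiv:2206.09876 (2022), §4 Problem 3 and eq. (1)–(2) (p. 8), §5 (p. 9), §6 Theorem 3
  (p. 10).
* Positive definiteness of autocorrelations / Bochner on finite abelian groups: folklore.
-/

noncomputable section

open Complex Finset
open scoped Real BigOperators ComplexConjugate

namespace Literature.Barriers.AtomisticToContinuum

section Autoconv

variable {d : ℕ} {m : ℕ} [NeZero m]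

/-- The **cyclic autoconvolution** `(β ∗ β)(x) = ∑_z β(z) β(x - z)` of an integer function on
`ℤ_m^d`. [folklore] -/
def autoconv (β : (Fin d → ZMod m) → ℤ) (x : Fin d → ZMod m) : ℤ := ∑ z, β z * β (x - z)

/-- The character sum `β̂(y) = ∑_x β(x) e^{2πi⟨x,y⟩/m}` of an integer function on `ℤ_m^d`.
[folklore] -/
def intHat (β : (Fin d → ZMod m) → ℤ) (y : Fin d → ZMod m) : ℂ :=
  ∑ x, (β x : ℂ) * ZMod.stdAddChar (x ⬝ᵥ y)

/-- **Convolution theorem** for the autoconvolution: `∑_x (β∗β)(x) e(⟨x,y⟩) = β̂(y)²`. [folklore] -/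
theorem sum_autoconv_mul_stdAddChar (β : (Fin d → ZMod m) → ℤ) (y : Fin d → ZMod m) :
    ∑ x, (autoconv β x : ℂ) * ZMod.stdAddChar (x ⬝ᵥ y) = intHat β y * intHat β y := by
  classical
  unfold autoconv intHat
  push_cast
  simp_rw [Finset.sum_mul]
  rw [Finset.sum_comm]
  refine Finset.sum_congr rfl fun z _ ↦ ?_
  rw [Finset.mul_sum]
  -- reindex `x ↦ x + z` on the left
  conv_lhs => rw [← Equiv.sum_comp (Equiv.addRight z)]
  refine Finset.sum_congr rfl fun x _ ↦ ?_
  simp only [Equiv.coe_addRight, add_sub_cancel_right]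
  rw [add_dotProduct, AddChar.map_add_eq_mul]
  ring

/-- The conjugate of the standard character is the character at the negative. [folklore] -/
theorem conj_stdAddChar (j : ZMod m) : conj (ZMod.stdAddChar j : ℂ) = ZMod.stdAddChar (-j) := by
  rw [ZMod.stdAddChar_apply, ZMod.stdAddChar_apply, AddChar.map_neg_eq_inv, Circle.coe_inv_eq_conj]

/-- For an **even** integer function the character sum `β̂(y)` is real. [folklore] -/
theorem intHat_im_eq_zero {β : (Fin d → ZMod m) → ℤ} (hβ : ∀ x, β (-x) = β x)
    (y : Fin d → ZMod m) : (intHat β y).im = 0 := by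
  classical
  have hconj : conj (intHat β y) = intHat β y := by
    unfold intHat
    rw [map_sum]
    rw [← Equiv.sum_comp (Equiv.neg (Fin d → ZMod m))]
    refine Finset.sum_congr rfl fun x _ ↦ ?_
    simp only [Equiv.neg_apply, map_mul, map_intCast, hβ x, neg_dotProduct,
      conj_stdAddChar, neg_neg]
  have := congr_arg Complex.im hconj
  rw [Complex.conj_im] at this
  linarith

/-- **Autoconvolutions of even integer functions are positive definite**:
`Re ∑_x (β∗β)(x) e(⟨x,y⟩) = β̂(y)² ≥ 0`. [folklore] -/
theorem re_sum_autoconv_nonneg {β : (Fin d → ZMod m) → ℤ} (hβ : ∀ x, β (-x) = β x)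
    (y : Fin d → ZMod m) :
    0 ≤ (∑ x, (autoconv β x : ℂ) * ZMod.stdAddChar (x ⬝ᵥ y)).re := by
  rw [sum_autoconv_mul_stdAddChar, Complex.mul_re, intHat_im_eq_zero hβ, mul_zero, sub_zero]
  exact mul_self_nonneg _

/-- The autoconvolution of an even function at `0` is `∑ β²`. [folklore] -/
theorem autoconv_zero {β : (Fin d → ZMod m) → ℤ} (hβ : ∀ x, β (-x) = β x) :
    autoconv β 0 = ∑ z, β z ^ 2 := by
  unfold autoconv
  refine Finset.sum_congr rfl fun z _ ↦ ?_
  rw [zero_sub, hβ, sq]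

end Autoconv

/-! ## The certificate attached to an even integer function -/

section Certificate

variable {d : ℕ} {m : ℕ} [NeZero m] (R : ℕ) (β : (Fin d → ZMod m) → ℤ)

/-- The **correction mass**: the `ℓ¹`-size of what must be changed in `β∗β` to make it vanish on
the shell `0 < |x|² < R` and non-negative elsewhere. [folklore] -/
def corrMass : ℤ :=
  ∑ x, if x = 0 then 0 else
    if zmodSqNorm x < R then |autoconv β x| else max (-(autoconv β x)) 0

/-- The value at the origin of the corrected certificate: `(β∗β)(0) + corrMass`. [folklore] -/
def certNu0 : ℤ := autoconv β 0 + corrMass R β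

/-- The total mass `∑_x ν(x)` of the corrected certificate. [folklore] -/
def certTot : ℤ :=
  certNu0 R β + ∑ x, if x = 0 then 0 else
    if zmodSqNorm x < R then 0 else max (autoconv β x) 0

/-- The **corrected certificate** `ν`: `ν(0) = (β∗β)(0) + corrMass`, `ν = 0` on the shell,
`ν = max(β∗β, 0)` elsewhere. [folklore] -/
def certNu (x : Fin d → ZMod m) : ℝ :=
  if x = 0 then (certNu0 R β : ℝ) else
    if zmodSqNorm x < R then 0 else ((max (autoconv β x) 0 : ℤ) : ℝ)

/-- The correction mass is non-negative. [folklore] -/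
theorem corrMass_nonneg : 0 ≤ corrMass R β := by
  unfold corrMass
  refine Finset.sum_nonneg fun x _ ↦ ?_
  split_ifs
  · exact le_rfl
  · exact abs_nonneg _
  · exact le_max_right _ _

/-- **The corrected certificate is a discrete dual certificate** whenever `β` is even and
`ν(0) > 0`: positivity of `Re ν̂` is `β̂² ≥ 0` plus an `ℓ¹` bound on the correction, which is
dominated by the mass `corrMass` added at the origin. [folklore] -/
theorem isDiscreteDualCertificate_certNu (hβ : ∀ x, β (-x) = β x) (h0 : 0 < certNu0 R β) :
    IsDiscreteDualCertificate R (certNu R β) where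
  nonneg x := by
    unfold certNu
    split_ifs
    · exact_mod_cast h0.le
    · exact le_rfl
    · exact_mod_cast le_max_right _ _
  eq_zero_of_lt x hx hlt := by
    unfold certNu
    rw [if_neg hx, if_pos hlt]
  zero_pos := by
    unfold certNu
    rw [if_pos rfl]
    exact_mod_cast h0
  re_sum_nonneg y := by
    classical
    -- split `ν = β∗β + c`
    set c : (Fin d → ZMod m) → ℝ := fun x ↦ certNu R β x - (autoconv β x : ℝ) with hc
    have hsplit : (∑ x, (certNu R β x : ℂ) * ZMod.stdAddChar (x ⬝ᵥ y)) =
        (∑ x, (autoconv β x : ℂ) * ZMod.stdAddChar (x ⬝ᵥ y)) +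
          ∑ x, (c x : ℂ) * ZMod.stdAddChar (x ⬝ᵥ y) := by
      rw [← Finset.sum_add_distrib]
      refine Finset.sum_congr rfl fun x _ ↦ ?_
      rw [hc]
      push_cast
      ring
    rw [hsplit, Complex.add_re]
    refine add_nonneg (re_sum_autoconv_nonneg hβ y) ?_
    -- the correction: the origin carries `corrMass`, the rest is bounded by it in `ℓ¹`
    rw [Complex.re_sum]
    have hterm : ∀ x, x ≠ 0 → -|c x| ≤ ((c x : ℂ) * ZMod.stdAddChar (x ⬝ᵥ y)).re := by
      intro x _
      have h1 := Complex.abs_re_le_norm ((c x : ℂ) * ZMod.stdAddChar (x ⬝ᵥ y))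
      rw [norm_mul, Complex.norm_real, Real.norm_eq_abs, ZMod.stdAddChar_apply, Circle.norm_coe,
        mul_one] at h1
      exact (abs_le.mp h1).1
    have h0term : ((c 0 : ℂ) * ZMod.stdAddChar ((0 : Fin d → ZMod m) ⬝ᵥ y)).re = corrMass R β := by
      rw [zero_dotProduct, AddChar.map_zero_eq_one, mul_one, Complex.ofReal_re, hc]
      simp only [certNu, if_true, certNu0]
      push_cast
      ring
    -- `|c x|` off the origin, and `∑_{x ≠ 0} |c x| = corrMass`
    have habs : ∀ x, x ≠ 0 → |c x| =
        (if zmodSqNorm x < R then |(autoconv β x : ℝ)| else max (-(autoconv β x : ℝ)) 0) := by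
      intro x hx
      rw [hc]
      simp only [certNu, if_neg hx]
      split_ifs with hlt
      · rw [zero_sub, abs_neg]
      · push_cast
        rw [← max_sub_sub_right, sub_self, zero_sub, max_comm]
        exact abs_of_nonneg (le_max_right _ _)
    have hsum_abs : ∑ x, (if x = 0 then (0 : ℝ) else |c x|) = (corrMass R β : ℝ) := by
      unfold corrMass
      push_cast
      refine Finset.sum_congr rfl fun x _ ↦ ?_
      by_cases hx : x = 0
      · rw [if_pos hx, if_pos hx]
      · rw [if_neg hx, if_neg hx, habs x hx]
    have hlow : ∀ x, (if x = 0 then (corrMass R β : ℝ) else 0) - (if x = 0 then 0 else |c x|) ≤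
        ((c x : ℂ) * ZMod.stdAddChar (x ⬝ᵥ y)).re := by
      intro x
      by_cases hx : x = 0
      · subst hx
        rw [if_pos rfl, if_pos rfl, sub_zero, h0term]
      · rw [if_neg hx, if_neg hx, zero_sub]
        exact hterm x hx
    calc (0 : ℝ) = ∑ x, ((if x = 0 then (corrMass R β : ℝ) else 0) - (if x = 0 then 0 else |c x|)) := by
          rw [Finset.sum_sub_distrib, hsum_abs, Finset.sum_ite_eq']
          simp
      _ ≤ ∑ x, ((c x : ℂ) * ZMod.stdAddChar (x ⬝ᵥ y)).re := Finset.sum_le_sum fun x _ ↦ hlow x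

/-- The corrected certificate at the origin. [folklore] -/
theorem certNu_zero : certNu R β 0 = certNu0 R β := by
  unfold certNu; rw [if_pos rfl]

/-- The total mass of the corrected certificate. [folklore] -/
theorem sum_certNu : ∑ x, certNu R β x = (certTot R β : ℝ) := by
  classical
  have hx : ∀ x, certNu R β x = (if x = 0 then (certNu0 R β : ℝ) else 0) +
      (if x = 0 then 0 else if zmodSqNorm x < R then 0 else ((max (autoconv β x) 0 : ℤ) : ℝ)) := by
    intro x
    unfold certNu
    split_ifs <;> simp
  unfold certTot
  rw [Finset.sum_congr rfl (fun x _ ↦ hx x), Finset.sum_add_distrib, Finset.sum_ite_eq']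
  simp only [Finset.mem_univ, if_true]
  push_cast
  rfl

/-- **Bound criterion** for the corrected certificate, in integers: if `ν(0) = NU0 > 0`,
`∑ν = TOT` and `4^d m^{2d} NU0² Tn² < R^d TOT² Td²` then `Tn/Td < (√R/2)^d m^{-d} TOT/NU0`.
[folklore] -/
theorem lt_discreteDualBound_certNu {NU0 TOT Tn Td : ℕ} (hN : certNu0 R β = NU0)
    (hT : certTot R β = TOT) (h0 : 0 < NU0) (hTd : 0 < Td)
    (h : 4 ^ d * m ^ (2 * d) * NU0 ^ 2 * Tn ^ 2 < R ^ d * TOT ^ 2 * Td ^ 2) :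
    (Tn / Td : ℝ) < discreteDualBound R (certNu R β) := by
  have hm : (0 : ℝ) < m := Nat.cast_pos.mpr (Nat.pos_of_ne_zero (NeZero.ne m))
  have hN' : (certNu R β 0 : ℝ) = NU0 := by rw [certNu_zero, hN]; push_cast; rfl
  have hT' : (∑ x, certNu R β x) = (TOT : ℝ) := by rw [sum_certNu, hT]; push_cast; rfl
  rw [discreteDualBound, hN', hT']
  have hb : 0 ≤ (Real.sqrt R / 2) ^ d / (m : ℝ) ^ d * ((TOT : ℝ) / NU0) := by positivity
  refine lt_of_pow_lt_pow_left₀ 2 hb ?_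
  have h' : (4 : ℝ) ^ d * (m : ℝ) ^ (2 * d) * (NU0 : ℝ) ^ 2 * (Tn : ℝ) ^ 2 <
      (R : ℝ) ^ d * (TOT : ℝ) ^ 2 * (Td : ℝ) ^ 2 := by exact_mod_cast h
  have hsq : ((Real.sqrt R / 2) ^ d / (m : ℝ) ^ d * ((TOT : ℝ) / NU0)) ^ 2 =
      (R : ℝ) ^ d * (TOT : ℝ) ^ 2 / ((4 : ℝ) ^ d * (m : ℝ) ^ (2 * d) * (NU0 : ℝ) ^ 2) := by
    have hR : ((Real.sqrt R / 2) ^ d) ^ 2 = (R : ℝ) ^ d / 4 ^ d := by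
      rw [← pow_mul, mul_comm, pow_mul, div_pow, Real.sq_sqrt (Nat.cast_nonneg _), ← div_pow]
      norm_num
    rw [mul_pow, div_pow, hR, div_pow, ← pow_mul, mul_comm d 2]
    field_simp
  rw [hsq, div_pow, div_lt_div_iff₀ (by positivity) (by positivity)]
  linarith

/-- **Existence of a discrete dual certificate from an even integer function**: the bundle of
`isDiscreteDualCertificate_certNu` and `lt_discreteDualBound_certNu`. [folklore] -/
theorem exists_dualCertificate_of_even (hβ : ∀ x, β (-x) = β x) {NU0 TOT Tn Td : ℕ}
    (hN : certNu0 R β = NU0) (hT : certTot R β = TOT) (h0 : 0 < NU0) (hTd : 0 < Td)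
    (h : 4 ^ d * m ^ (2 * d) * NU0 ^ 2 * Tn ^ 2 < R ^ d * TOT ^ 2 * Td ^ 2) :
    ∃ ν : (Fin d → ZMod m) → ℝ, IsDiscreteDualCertificate R ν ∧
      (Tn / Td : ℝ) < discreteDualBound R ν :=
  ⟨certNu R β, isDiscreteDualCertificate_certNu R β hβ (by rw [hN]; exact_mod_cast h0),
    lt_discreteDualBound_certNu R β hN hT h0 hTd h⟩

end Certificate

end Literature.Barriers.AtomisticToContinuum

end
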